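import Summits.Parity.BatemanHorn.Theorems.SoloInformedRootPairCorrelation

/-!
# The ceiling of intra-modulus methods for the `ℓ¹` profile

Informed soloist `solo-Parity-informed` (session 144), conjunct `BatemanHorn`, the `d ≥ 3` rung BELOW the parity
wall.  The open hypothesis of the rung is the `ℓ¹` profile `∑_{1≤|h|≤H} |T(h)| ≤ ε·E + C·H·E^{1−η}`,
`T(h) = ∑_{E<e≤E'} S_g(h;e)`, up to `H = E^{θ}` (`HooleyMeanProfile`).  Hooley's method for
`∑_{e≤x} S_g(h;e) = o(x)` (1964; both assemblies in the tree) writes `e = ab` and begins with the triangle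
inequality over the cofactor — `|∑_b S_g(h;ab)| ≤ ∑_b ρ_g(b)|S_g(h b̄;a)|`
(`Literature.NumberTheory.Sieve.norm_sum_polyRootWeylSum_mul_le`), a majorant of `∑_b |S_g(h;ab)|` since
`|S_g(h;ab)| = |S_g(h b̄;a)|·|S_g(h ā;b)|` — so what it bounds is a majorant of `∑_e |S_g(h;e)|`: the absolute values
sit INSIDE the sum over the moduli, and the cancellation it finds is inside single moduli (the second moment over the
twists `h b̄` of one modulus `a`).  This file records, by Fejér positivity alone, how far such INTRA-modulus bounds
can reach:

* `card_mul_le_rootPairSum`: the diagonal bound `H·N ≤ rootPairSum g E E' H` (`F_H(0) = H`);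
* `card_mul_sub_card_le_sum_Icc_norm_sq`: `N·(H − N) ≤ ∑_{1≤h≤H}(|T(h)|² + |T(−h)|²)`;
* for ONE modulus `q` with `r = ρ_g(q) ≥ 1` roots (`sub_rootCount_le_sum_norm_hooleySum`):
  `H − r ≤ ∑_{1≤h≤H}(|S_g(h;q)| + |S_g(−h;q)|)` — the root sums of a single modulus cannot be small at more than
  `r` of any `H` consecutive frequencies, whatever the roots are;
* `sub_mul_card_le_sum_sum_norm_hooleySum` (**the ceiling**): for every range and every `R`,
  `(H − R)·#{E<e≤E' : 1 ≤ ρ_g(e) ≤ R} ≤ ∑_{1≤h≤H} ∑_{E<e≤E'} (|S_g(h;e)| + |S_g(−h;e)|)`;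
* `card_rootedModuli_le_of_sum_sum_norm_le`: hence an intra-modulus bound `∑_{1≤h≤H}∑_{E<e≤E'}(|S_g(h;e)| +
  |S_g(−h;e)|) ≤ ε·E` at a scale `H ≥ 2R` forces `#{E<e≤E' : 1 ≤ ρ_g(e) ≤ R} ≤ 2εE/H`.

Reading (prose, SHARPEST-STATEMENT §4.A of the line): with `R = deg g` the set counted contains every prime
`p ∈ (E,2E]` not dividing the discriminant with a root of `g`, which number `≥ (c_g + o(1))·E/log E`, `c_g ≥ 1/deg g`
(Chebotarev–Frobenius); so no intra-modulus argument gives the `ℓ¹` profile's `ε`-part beyond `H ≈ (2/c_g)·ε·log E`,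
while the profile is needed up to `H = E^{θ}`, `θ > 2/3` (cubic case): the open range demands cancellation AMONG the
moduli for single frequencies (`|∑_e S_g(h;e)|` genuinely smaller than `∑_e |S_g(h;e)|`).
-/

namespace Summit.Parity.BatemanHorn.Theorems

open scoped BigOperators
open Finset Polynomial Literature.NumberTheory.Sieve
open Literature.Barriers.AtomisticToContinuum.HeatConduction (fejer fejer_nonneg)

/-- `F_m(0) = m`. [folklore] -/
theorem fejer_zero_right (m : ℕ) : fejer m 0 = m := by
  unfold fejer
  simp only [mul_zero, Real.cos_zero, Real.sin_zero, sum_const, card_range, nsmul_eq_mul, mul_one]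
  rcases Nat.eq_zero_or_pos m with rfl | hm
  · simp
  · have : (m : ℝ) ≠ 0 := by positivity
    field_simp
    ring

/-- The diagonal bound `H·N ≤ rootPairSum g E E' H` (`N = #rootPoints`; keep the pairs `p = p'`). [this work] -/
theorem card_mul_le_rootPairSum (g : ℤ[X]) (E E' H : ℕ) :
    (H : ℝ) * #(rootPoints g E E') ≤ rootPairSum g E E' H := by
  unfold rootPairSum
  calc (H : ℝ) * #(rootPoints g E E') = ∑ p ∈ rootPoints g E E', (H : ℝ) := by
        rw [sum_const, nsmul_eq_mul, mul_comm]
    _ ≤ _ := sum_le_sum fun p hp => by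
        have h := single_le_sum (f := fun p' : (Σ _ : ℕ, ℕ) => fejer H ((p.2 : ℝ) / p.1 - (p'.2 : ℝ) / p'.1))
          (fun p' _ => fejer_nonneg _ _) hp
        simpa only [sub_self, fejer_zero_right] using h

/-- `N·(H − N) ≤ ∑_{1≤h≤H}(‖T(h)‖² + ‖T(−h)‖²)` (`= (HN − N²) ≤ rootPairSum − N² ≤ ∑`). [this work] -/
theorem card_mul_sub_card_le_sum_Icc_norm_sq (g : ℤ[X]) (E E' H : ℕ) :
    (#(rootPoints g E E') : ℝ) * ((H : ℝ) - #(rootPoints g E E')) ≤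
      ∑ h ∈ Icc 1 H, (‖∑ e ∈ Ioc E E', hooleySum g e h‖ ^ 2 +
        ‖∑ e ∈ Ioc E E', hooleySum g e (-(h : ℤ))‖ ^ 2) := by
  have h1 := rootPairSum_sub_sq_le g E E' H
  have h2 := card_mul_le_rootPairSum g E E' H
  have h3 : (#(rootPoints g E E') : ℝ) * ((H : ℝ) - #(rootPoints g E E')) =
      (H : ℝ) * #(rootPoints g E E') - (#(rootPoints g E E') : ℝ) ^ 2 := by ring
  linarith

/-! ### One modulus -/

/-- The root points of the range `(k, k+1]` are the roots modulo `k + 1`: `N = ρ_g(k+1)`. [this work] -/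
theorem card_rootPoints_single (g : ℤ[X]) (k : ℕ) :
    #(rootPoints g k (k + 1)) = polyRootCountMod ![g] (k + 1) := by
  rw [card_rootPoints, Nat.Ioc_succ_singleton, sum_singleton]

/-- `T(h)` of the range `(k, k+1]` is `S_g(h; k+1)`. [this work] -/
theorem sum_Ioc_single_hooleySum (g : ℤ[X]) (k : ℕ) (h : ℤ) :
    ∑ e ∈ Ioc k (k + 1), hooleySum g e h = hooleySum g (k + 1) h := by
  rw [Nat.Ioc_succ_singleton, sum_singleton]

/-- For one modulus `q ≥ 1` with `r = ρ_g(q)` roots: `r·(H − r) ≤ ∑_{1≤h≤H}(|S_g(h;q)|² + |S_g(−h;q)|²)`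
(Fejér positivity over the `r` root fractions `ν/q`). [this work] -/
theorem rootCount_mul_sub_le_sum_norm_sq_hooleySum (g : ℤ[X]) {q : ℕ} (hq : 1 ≤ q) (H : ℕ) :
    (polyRootCountMod ![g] q : ℝ) * ((H : ℝ) - polyRootCountMod ![g] q) ≤
      ∑ h ∈ Icc 1 H, (‖hooleySum g q h‖ ^ 2 + ‖hooleySum g q (-(h : ℤ))‖ ^ 2) := by
  obtain ⟨k, rfl⟩ : ∃ k, q = k + 1 := ⟨q - 1, by omega⟩
  have h := card_mul_sub_card_le_sum_Icc_norm_sq g k (k + 1) H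
  simp only [card_rootPoints_single, sum_Ioc_single_hooleySum] at h
  exact h

/-- For one modulus `q ≥ 1` with `ρ_g(q) ≥ 1`: `H − ρ_g(q) ≤ ∑_{1≤h≤H}(|S_g(h;q)| + |S_g(−h;q)|)` — the root sums of
a single modulus are small at no more than `ρ_g(q)` of any `H` consecutive frequencies (`|S|² ≤ ρ·|S|`). [this work] -/
theorem sub_rootCount_le_sum_norm_hooleySum (g : ℤ[X]) {q : ℕ} (hq : 1 ≤ q)
    (hr : 1 ≤ polyRootCountMod ![g] q) (H : ℕ) :
    (H : ℝ) - polyRootCountMod ![g] q ≤ ∑ h ∈ Icc 1 H, (‖hooleySum g q h‖ + ‖hooleySum g q (-(h : ℤ))‖) := by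
  set r : ℝ := (polyRootCountMod ![g] q : ℝ) with hrdef
  have hr' : (1 : ℝ) ≤ r := by rw [hrdef]; exact_mod_cast hr
  have hsq : ∀ h : ℤ, ‖hooleySum g q h‖ ^ 2 ≤ r * ‖hooleySum g q h‖ := fun h => by
    rw [sq]
    exact mul_le_mul_of_nonneg_right (norm_hooleySum_le g q h) (norm_nonneg _)
  have h1 := rootCount_mul_sub_le_sum_norm_sq_hooleySum g hq H
  have h2 : ∑ h ∈ Icc 1 H, (‖hooleySum g q h‖ ^ 2 + ‖hooleySum g q (-(h : ℤ))‖ ^ 2) ≤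
      r * ∑ h ∈ Icc 1 H, (‖hooleySum g q h‖ + ‖hooleySum g q (-(h : ℤ))‖) := by
    rw [mul_sum]
    refine sum_le_sum fun h _ => ?_
    rw [mul_add]
    exact add_le_add (hsq h) (hsq (-(h : ℤ)))
  exact le_of_mul_le_mul_left (h1.trans h2) (by linarith)

/-! ### The ceiling -/

/-- **The ceiling of intra-modulus methods.**  For every range `(E, E']`, scale `H` and `R`:
`(H − R)·#{E<e≤E' : 1 ≤ ρ_g(e) ≤ R} ≤ ∑_{1≤h≤H} ∑_{E<e≤E'} (|S_g(h;e)| + |S_g(−h;e)|)`. [this work] -/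
theorem sub_mul_card_le_sum_sum_norm_hooleySum (g : ℤ[X]) (E E' H R : ℕ) :
    ((H : ℝ) - R) * #{e ∈ Ioc E E' | 1 ≤ polyRootCountMod ![g] e ∧ polyRootCountMod ![g] e ≤ R} ≤
      ∑ h ∈ Icc 1 H, ∑ e ∈ Ioc E E', (‖hooleySum g e h‖ + ‖hooleySum g e (-(h : ℤ))‖) := by
  rw [sum_comm]
  calc ((H : ℝ) - R) * #{e ∈ Ioc E E' | 1 ≤ polyRootCountMod ![g] e ∧ polyRootCountMod ![g] e ≤ R}
      = ∑ e ∈ {e ∈ Ioc E E' | 1 ≤ polyRootCountMod ![g] e ∧ polyRootCountMod ![g] e ≤ R}, ((H : ℝ) - R) := by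
        rw [sum_const, nsmul_eq_mul, mul_comm]
    _ ≤ ∑ e ∈ {e ∈ Ioc E E' | 1 ≤ polyRootCountMod ![g] e ∧ polyRootCountMod ![g] e ≤ R},
          ∑ h ∈ Icc 1 H, (‖hooleySum g e h‖ + ‖hooleySum g e (-(h : ℤ))‖) := by
        refine sum_le_sum fun e he => ?_
        obtain ⟨he', hr1, hrR⟩ := mem_filter.1 he
        have hq : 1 ≤ e := by have := (mem_Ioc.1 he').1; omega
        have hrR' : (polyRootCountMod ![g] e : ℝ) ≤ R := by exact_mod_cast hrR
        calc (H : ℝ) - R ≤ (H : ℝ) - polyRootCountMod ![g] e := by linarith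
          _ ≤ _ := sub_rootCount_le_sum_norm_hooleySum g hq hr1 H
    _ ≤ ∑ e ∈ Ioc E E', ∑ h ∈ Icc 1 H, (‖hooleySum g e h‖ + ‖hooleySum g e (-(h : ℤ))‖) :=
        sum_le_sum_of_subset_of_nonneg (filter_subset _ _) fun e _ _ =>
          sum_nonneg fun h _ => by positivity

/-- **Consequence.**  An intra-modulus bound `∑_{1≤h≤H} ∑_{E<e≤E'} (|S_g(h;e)| + |S_g(−h;e)|) ≤ ε·E` at a scale
`H ≥ 2R`, `H ≥ 1`, forces `#{E<e≤E' : 1 ≤ ρ_g(e) ≤ R} ≤ 2εE/H`.  (With `R = deg g` the set contains every prime of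
`(E, E']` coprime to the discriminant at which `g` has a root — `≫_g E/log E` of them for `E' = 2E` by
Chebotarev–Frobenius, prose — so such bounds stop at `H ≈ ε·log E`.) [this work] -/
theorem card_rootedModuli_le_of_sum_sum_norm_le (g : ℤ[X]) {E E' H R : ℕ} {ε : ℝ} (hRH : 2 * R ≤ H)
    (hH : 1 ≤ H)
    (hb : ∑ h ∈ Icc 1 H, ∑ e ∈ Ioc E E', (‖hooleySum g e h‖ + ‖hooleySum g e (-(h : ℤ))‖) ≤ ε * E) :
    (#{e ∈ Ioc E E' | 1 ≤ polyRootCountMod ![g] e ∧ polyRootCountMod ![g] e ≤ R} : ℝ) ≤ 2 * ε * E / H := by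
  have key := (sub_mul_card_le_sum_sum_norm_hooleySum g E E' H R).trans hb
  have hHR : (H : ℝ) / 2 ≤ (H : ℝ) - R := by
    have : (2 * R : ℝ) ≤ H := by exact_mod_cast hRH
    linarith
  have hHpos : (0 : ℝ) < H := by exact_mod_cast hH
  have hc0 : (0 : ℝ) ≤ #{e ∈ Ioc E E' | 1 ≤ polyRootCountMod ![g] e ∧ polyRootCountMod ![g] e ≤ R} :=
    Nat.cast_nonneg _
  have h2 : (H : ℝ) / 2 * #{e ∈ Ioc E E' | 1 ≤ polyRootCountMod ![g] e ∧ polyRootCountMod ![g] e ≤ R} ≤ ε * E :=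
    (mul_le_mul_of_nonneg_right hHR hc0).trans key
  rw [le_div_iff₀ hHpos]
  linarith

end Summit.Parity.BatemanHorn.Theorems
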